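import Summits.QuantumFields.BalabanUV.T4Continuum.Support.NE7K1LinTwoRunLines

/-!
# NE7K1LinTwoRunJensen — row NE7 (node U5), candidate route HOM, path H1L, cell K1-lin(s): TWO-RUN COMPARISON AT
# `A = 0`, THE SHARP LOWER HALF — `⟨V, P_A V⟩ ≤ ⟨V, P_B^{Schur}V⟩` (constant ONE: Löwner `P_A ⪯ P_B^{Schur}`), by the weighted
# straight-line Jensen count `L^{d+1}·Σ_xΣ_{y~x}(V_x − V_y)² ≤ 2L²·Σ_k(φ(k₊) − φ(k₋))²`

Lineage `b2b-balaban-t4-ne7-p2` (CRUX PROVER NE7 #2), generation 65; successor of `NE7K1LinTwoRunLower` (p292896 ✓, the crude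
constant `c₁ = (3((d+1)L² + 1)L^{d−1})⁻¹`), over the straight-line bookkeeping of `NE7K1LinTwoRunLines` (`linePt`, `bondE`, `lineSum`,
`line_telescope`, `sum_lineSum_le`).  THIS FILE CONSUMES, in kernel, the lens-2 supply (K2)♯ (t4-ne7-idea-2 gen 26,
`HOME/t4/ideate/NE7/lens2-g26/K2-SHARP-JENSEN-SUPPLY.md`, graded SOUND at PRICING-NE7 v18 §111 (d)): «LEMMA W — weighted two-block
Jensen along straight `L`-step lines, constant exactly 1».  Objects of `NE7K1LinSchurLineU1`: `R′` a union of `L`-blocks (run B's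
fine region), `R = R′.image (blk L)` (run A's lattice), `runA = P_A`, `runB = H_B`, `twoCutoffLine 1 = P_B^{Schur}`.  All [folklore]:

* §1 ONE COARSE BOND (`pair_sq_le_lineSum`): for `Y = X + e_μ` and `φ` with block sums `L^{d+1}V`,
  `L^{d+1}(V_Y − V_X) = Σ_jΣ_{m<L}(φ(LX+j+(m+1)e_μ) − φ(LX+j+m·e_μ))` (telescoping along the `L^{d+1}` lines), so by Cauchy–Schwarz
  over the `L^{d+1}·L` increments `L^{d+1}(V_X − V_Y)² ≤ L·lineSum_μ(X)`.
* §2 **`coarseDirichlet_le_sharp`**: `L^{d+1}·Σ_xΣ_{y~x}(V_x − V_y)² ≤ 2L²·Σ_k(φ(k₊) − φ(k₋))²` (the ordered pair sum counts each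
  coarse bond twice; `y ~ x` iff `y = x ± e_μ`, `B4Reflection242.mem_nbrs`; per direction at most ONE `y = x + e_μ`; then the
  multiplicity count `NE7K1LinTwoRunLines.sum_lineSum_le`) — against `NE7K1LinTwoRunBonds.coarseDirichlet_le`'s `(6(d+1)L² + 6)`: the
  factor `L^{1−d}` is the CORRECT scaling (run A's Dirichlet form is `n²×`, run B's `L^{−(d+1)}(nL)²×` the bond energy) and the
  numerical constant 2 is the ordered-pair factor, i.e. Jensen's constant is ONE.
* §3 **`runA_form_le_schurB_sharp`**: `⟨V, runA V⟩ ≤ ⟨V, twoCutoffLine … 1 V⟩` for every `V` (`a > 0`, `n ≥ 1`, `R′` a union of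
  `nL`-blocks) — `c₁ = 1`: the Schur form is attained at the optimal fluctuation (`schur_form_eq_min`), the averaging parts are EQUAL
  (`avgPart_eq`), and the Dirichlet parts compare by §2 with EXACTLY the factor the two normalisations `n²` vs `L^{−(d+1)}(nL)²` absorb.
  Consequence (next file `NE7K1LinTwoRunMonotone`): the two-cutoff line `(1−s)P_A + sP_B^{Schur}` is LÖWNER-NONDECREASING in `s`.

Numerical witness that 1 is sharp (lens 2's toy `k2_loewner_toy.py`, 10 regions, d+1 ≤ 3): the minimal generalised eigenvalue of
`(P_B^{Schur}, P_A)` is 1.000000 in every case (attained on constants, where the averaging identity is an equality and both Dirichlet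
parts vanish).

HONEST FRAMING: Gaussian `A = 0`, finite regions, [folklore] over the tree's `B4Lower18` ∕ `NE7K1Lin*` certificates; a supplier
inequality of lens 2 (LÖW B1(i)) made kernel; nothing printed asserted; no `sorry`.  FIXED FINITE T⁴, rung (B)+1; NE7 NOT PRINTED ∕ NOT
PROVED; spine 0∕9; NOT infinite volume, NOT mass gap, NOT Clay.  HONEST DEPENDENCY: continuum YM on T⁴ ⇐ BetaPertH ∧ nine spine
estimates (0/9 proved); BetaPertH ⇐ (D1) ∧ (D4) ∧ CAP+tail; G-an2-4 gates asym, D1 and NE2/3/4.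
-/

noncomputable section

open Finset Matrix

namespace Summit.QuantumFields.BalabanUV.T4Continuum.NE7K1LinTwoRunJensen

open Literature.MathematicalPhysics.QuantumFieldTheory.Balaban1983to89
open Literature.MathematicalPhysics.QuantumFieldTheory.Balaban1983to89.B4Reflection242
open Literature.MathematicalPhysics.QuantumFieldTheory.Balaban1983to89.B4BoxCov237
open Literature.MathematicalPhysics.QuantumFieldTheory.Balaban1983to89.B4Lower18
open Literature.MathematicalPhysics.QuantumFieldTheory.Balaban1983to89.B4Thm110ZeroBox (blk_blk)
open Literature.MathematicalPhysics.QuantumFieldTheory.Balaban1983to89.B4Green244 (finePt)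
open NE7K1LinSchurLineForm NE7K1LinSchurLineCoords NE7K1LinBlockCoords NE7K1LinSchurLineU1 NE7K1LinTwoRunKit
  NE7K1LinTwoRunUpper NE7K1LinTwoRunBonds NE7K1LinTwoRunLower NE7K1LinTwoRunLines

variable {d : ℕ}


/-! ### §1 One coarse bond: Cauchy–Schwarz over the telescoped straight lines -/

section Pair

variable {L : ℕ} [NeZero L] {R' : Finset (Fin (d + 1) → ℤ)}

/-- **STRAIGHT-LINE JENSEN FOR ONE COARSE BOND**: for `Y = X + e_μ` in `R` and `φ` with `L`-block sums `L^{d+1}V`,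
`L^{d+1}·(V_X − V_Y)² ≤ L·lineSum_μ(X)` (Cauchy–Schwarz over the `L^{d+1}·L` increments of the telescoped block-sum
difference). [folklore] -/
theorem pair_sq_le_lineSum (hR'L : IsBlockUnion L R') (X Y : ↥(R'.image (blk L))) {μ : Fin (d + 1)} (hY : Y.1 = X.1 + uvec μ) (φ : ↥R' → ℝ)
    (V : ↥(R'.image (blk L)) → ℝ)
    (hφ : ∀ b, ∑ x' ∈ Finset.univ.filter (fun x' => rblk L R' x' = b), φ x' = (L : ℝ) ^ (d + 1) * V b) :
    (L : ℝ) ^ (d + 1) * (V X - V Y) ^ 2 ≤ (L : ℝ) * lineSum R' φ μ X := by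
  classical
  have hL : 1 ≤ L := NeZero.one_le
  have hLpow : (0 : ℝ) < (L : ℝ) ^ (d + 1) := pow_pos (by exact_mod_cast hL) _
  -- the increments
  set c : (Fin (d + 1) → Fin L) → ℕ → ℝ := fun j m =>
    extZ R' φ (linePt L X.1 μ j (m + 1)) - extZ R' φ (linePt L X.1 μ j m) with hc
  -- the block-sum difference as the double sum of increments
  have hdiff : (L : ℝ) ^ (d + 1) * (V Y - V X) = ∑ j : Fin (d + 1) → Fin L, ∑ m ∈ Finset.range L, c j m := by
    rw [mul_sub, ← hφ Y, ← hφ X, blockSum_eq_sum_chart hR'L φ Y, blockSum_eq_sum_chart hR'L φ X, ← Finset.sum_sub_distrib]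
    exact Finset.sum_congr rfl fun j _ => line_telescope hR'L X Y hY φ j
  -- squares of increments are bond energies (both ends of each bond lie in `R′`)
  have hsq : ∀ j, ∀ m ∈ Finset.range L, c j m ^ 2 = bondE R' φ μ (linePt L X.1 μ j m) := by
    intro j m hm
    have hm' : m < L := Finset.mem_range.1 hm
    have h1 : linePt L X.1 μ j m ∈ R' := linePt_mem hR'L X Y hY j hm'.le
    have h2 : linePt L X.1 μ j m + uvec μ ∈ R' := by
      rw [← linePt_succ]
      exact linePt_mem hR'L X Y hY j hm'
    simp only [hc, bondE, if_pos (And.intro h1 h2), linePt_succ]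
  -- Cauchy–Schwarz over the `L^{d+1}·L` increments
  have hCS : (∑ j : Fin (d + 1) → Fin L, ∑ m ∈ Finset.range L, c j m) ^ 2 ≤
      ((L : ℝ) ^ (d + 1) * L) * ∑ j : Fin (d + 1) → Fin L, ∑ m ∈ Finset.range L, c j m ^ 2 := by
    rw [← Finset.sum_product' Finset.univ (Finset.range L) (fun j m => c j m),
      ← Finset.sum_product' Finset.univ (Finset.range L) (fun j m => c j m ^ 2)]
    refine sq_sum_le_card_mul_sum_sq.trans (le_of_eq ?_)
    rw [Finset.card_product, Finset.card_univ, Fintype.card_fun, Fintype.card_fin, Fintype.card_fin, Finset.card_range]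
    push_cast
    ring
  have hsum : ∑ j : Fin (d + 1) → Fin L, ∑ m ∈ Finset.range L, c j m ^ 2 = lineSum R' φ μ X := by
    unfold lineSum
    exact Finset.sum_congr rfl fun j _ => Finset.sum_congr rfl fun m hm => hsq j m hm
  have key : ((L : ℝ) ^ (d + 1)) ^ 2 * (V X - V Y) ^ 2 ≤ ((L : ℝ) ^ (d + 1) * L) * lineSum R' φ μ X := by
    have e : ((L : ℝ) ^ (d + 1)) ^ 2 * (V X - V Y) ^ 2 = ((L : ℝ) ^ (d + 1) * (V Y - V X)) ^ 2 := by ring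
    rw [e, hdiff, ← hsum]
    exact hCS
  -- divide by `L^{d+1} > 0`
  refine le_of_mul_le_mul_left ?_ hLpow
  calc (L : ℝ) ^ (d + 1) * ((L : ℝ) ^ (d + 1) * (V X - V Y) ^ 2)
      = ((L : ℝ) ^ (d + 1)) ^ 2 * (V X - V Y) ^ 2 := by ring
    _ ≤ ((L : ℝ) ^ (d + 1) * L) * lineSum R' φ μ X := key
    _ = (L : ℝ) ^ (d + 1) * ((L : ℝ) * lineSum R' φ μ X) := by ring

/-! ### §2 The coarse Dirichlet sum against the fine bond energy, sharp -/

/-- at most one element of a finite set of lattice points has a given value: `Σ_{y∈S}[y = v]·c ≤ c` (`c ≥ 0`). [folklore] -/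
theorem sum_ite_val_eq_le {α : Type*} [DecidableEq α] (S : Finset α) (v : α) {c : ℝ} (hc : 0 ≤ c) :
    ∑ y : ↥S, (if y.1 = v then c else 0) ≤ c := by
  by_cases hv : v ∈ S
  · have h1 : ∀ y : ↥S, (y.1 = v) ↔ (y = ⟨v, hv⟩) := fun y => by rw [Subtype.ext_iff]
    simp_rw [h1]
    rw [Finset.sum_ite_eq']
    simp
  · have h1 : ∀ y : ↥S, ¬ (y.1 = v) := fun y h => hv (h ▸ y.2)
    simp only [h1, if_false, Finset.sum_const_zero]
    exact hc

/-- a triple sum with the innermost index moved outermost. [folklore] -/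
theorem sum_sum_sum_comm {α β γ : Type*} [Fintype α] [Fintype β] [Fintype γ] (g : α → β → γ → ℝ) :
    ∑ x, ∑ y, ∑ z, g x y z = ∑ z, ∑ x, ∑ y, g x y z := by
  calc ∑ x, ∑ y, ∑ z, g x y z = ∑ x, ∑ z, ∑ y, g x y z := Finset.sum_congr rfl fun x _ => Finset.sum_comm
    _ = ∑ z, ∑ x, ∑ y, g x y z := Finset.sum_comm

/-- **THE COARSE DIRICHLET SUM AGAINST THE FINE BOND ENERGY, SHARP**: for `φ` with `L`-block sums `L^{d+1}V_b`,
`L^{d+1}·Σ_xΣ_{y~x}(V_x − V_y)² ≤ 2L²·Σ_k(φ(k₊) − φ(k₋))²` — i.e. `Σ_{coarse ordered pairs}(∇V)² ≤ 2L^{1−d}·Σ_{fine bonds}(∇φ)²`, the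
factor 2 being the ordered-pair count: JENSEN WITH CONSTANT ONE (lens 2's (K2)♯ LEMMA W). [folklore] -/
theorem coarseDirichlet_le_sharp (hR'L : IsBlockUnion L R') (φ : ↥R' → ℝ) (V : ↥(R'.image (blk L)) → ℝ)
    (hφ : ∀ b, ∑ x' ∈ Finset.univ.filter (fun x' => rblk L R' x' = b), φ x' = (L : ℝ) ^ (d + 1) * V b) :
    (L : ℝ) ^ (d + 1) * ∑ x : ↥(R'.image (blk L)), ∑ y : ↥(R'.image (blk L)),
        (if y.1 ∈ nbrs x.1 then (V x - V y) ^ 2 else 0) ≤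
      2 * (L : ℝ) ^ 2 * ∑ k : RBond R', (φ (rtgt k) - φ (rsrc k)) ^ 2 := by
  classical
  have hL : 1 ≤ L := NeZero.one_le
  have hLpow : (0 : ℝ) < (L : ℝ) ^ (d + 1) := pow_pos (by exact_mod_cast hL) _
  -- the directional sums over ordered pairs `y = x + e_μ`
  set UP : Fin (d + 1) → ℝ := fun μ => ∑ x : ↥(R'.image (blk L)), ∑ y : ↥(R'.image (blk L)),
    (if y.1 = x.1 + uvec μ then (V x - V y) ^ 2 else 0) with hUP
  -- (1) the nearest-neighbour sum is at most twice the sum of the directional sums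
  have hpt : ∀ x y : ↥(R'.image (blk L)), (if y.1 ∈ nbrs x.1 then (V x - V y) ^ 2 else (0 : ℝ)) ≤
      ∑ μ : Fin (d + 1), ((if y.1 = x.1 + uvec μ then (V x - V y) ^ 2 else 0) +
        (if x.1 = y.1 + uvec μ then (V x - V y) ^ 2 else 0)) := by
    intro x y
    have hnn : ∀ μ : Fin (d + 1), 0 ≤ (if y.1 = x.1 + uvec μ then (V x - V y) ^ 2 else (0 : ℝ)) +
        (if x.1 = y.1 + uvec μ then (V x - V y) ^ 2 else 0) := fun μ => by
      have h1 : 0 ≤ (if y.1 = x.1 + uvec μ then (V x - V y) ^ 2 else (0 : ℝ)) := by split_ifs <;> positivity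
      have h2 : 0 ≤ (if x.1 = y.1 + uvec μ then (V x - V y) ^ 2 else (0 : ℝ)) := by split_ifs <;> positivity
      exact add_nonneg h1 h2
    split_ifs with h
    · obtain ⟨μ, hμ | hμ⟩ := mem_nbrs.1 h
      · have hμ' : y.1 = x.1 + uvec μ := hμ
        refine le_trans ?_ (Finset.single_le_sum (fun μ _ => hnn μ) (Finset.mem_univ μ))
        rw [if_pos hμ']
        have h2 : 0 ≤ (if x.1 = y.1 + uvec μ then (V x - V y) ^ 2 else (0 : ℝ)) := by split_ifs <;> positivity
        linarith
      · have hμ' : x.1 = y.1 + uvec μ := by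
          show x.1 = y.1 + Pi.single μ 1
          rw [hμ, sub_add_cancel]
        refine le_trans ?_ (Finset.single_le_sum (fun μ _ => hnn μ) (Finset.mem_univ μ))
        rw [if_pos hμ']
        have h2 : 0 ≤ (if y.1 = x.1 + uvec μ then (V x - V y) ^ 2 else (0 : ℝ)) := by split_ifs <;> positivity
        linarith
    · exact Finset.sum_nonneg fun μ _ => hnn μ
  have hswap : ∀ μ : Fin (d + 1), ∑ x : ↥(R'.image (blk L)), ∑ y : ↥(R'.image (blk L)),
      (if x.1 = y.1 + uvec μ then (V x - V y) ^ 2 else (0 : ℝ)) = UP μ := by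
    intro μ
    rw [hUP, Finset.sum_comm]
    refine Finset.sum_congr rfl fun x _ => Finset.sum_congr rfl fun y _ => ?_
    split_ifs <;> ring
  have h1 : ∑ x : ↥(R'.image (blk L)), ∑ y : ↥(R'.image (blk L)), (if y.1 ∈ nbrs x.1 then (V x - V y) ^ 2 else (0 : ℝ)) ≤
      2 * ∑ μ, UP μ := by
    calc ∑ x : ↥(R'.image (blk L)), ∑ y : ↥(R'.image (blk L)), (if y.1 ∈ nbrs x.1 then (V x - V y) ^ 2 else (0 : ℝ))
        ≤ ∑ x : ↥(R'.image (blk L)), ∑ y : ↥(R'.image (blk L)), ∑ μ : Fin (d + 1),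
            ((if y.1 = x.1 + uvec μ then (V x - V y) ^ 2 else 0) + (if x.1 = y.1 + uvec μ then (V x - V y) ^ 2 else 0)) :=
          Finset.sum_le_sum fun x _ => Finset.sum_le_sum fun y _ => hpt x y
      _ = ∑ μ : Fin (d + 1), ∑ x : ↥(R'.image (blk L)), ∑ y : ↥(R'.image (blk L)),
            ((if y.1 = x.1 + uvec μ then (V x - V y) ^ 2 else 0) + (if x.1 = y.1 + uvec μ then (V x - V y) ^ 2 else 0)) :=
          sum_sum_sum_comm _
      _ = ∑ μ : Fin (d + 1), (UP μ + UP μ) := by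
          refine Finset.sum_congr rfl fun μ _ => ?_
          simp only [Finset.sum_add_distrib]
          rw [hswap μ]
      _ = 2 * ∑ μ, UP μ := by
          rw [Finset.mul_sum]
          exact Finset.sum_congr rfl fun μ _ => by ring
  -- (2) per direction: `L^{d+1}·UP μ ≤ L²·Σ_z bondE_μ(z)`
  have h2 : ∀ μ, (L : ℝ) ^ (d + 1) * UP μ ≤ (L : ℝ) ^ 2 * ∑ z : ↥R', bondE R' φ μ z.1 := by
    intro μ
    have hstep : (L : ℝ) ^ (d + 1) * UP μ ≤ ∑ x : ↥(R'.image (blk L)), (L : ℝ) * lineSum R' φ μ x := by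
      rw [hUP, Finset.mul_sum]
      refine Finset.sum_le_sum fun x _ => ?_
      rw [Finset.mul_sum]
      calc ∑ y : ↥(R'.image (blk L)), (L : ℝ) ^ (d + 1) * (if y.1 = x.1 + uvec μ then (V x - V y) ^ 2 else 0)
          ≤ ∑ y : ↥(R'.image (blk L)), (if y.1 = x.1 + uvec μ then (L : ℝ) * lineSum R' φ μ x else 0) := by
            refine Finset.sum_le_sum fun y _ => ?_
            split_ifs with hy
            · exact pair_sq_le_lineSum hR'L x y hy φ V hφ
            · simp
        _ ≤ (L : ℝ) * lineSum R' φ μ x :=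
            sum_ite_val_eq_le _ _ (mul_nonneg (Nat.cast_nonneg L) (lineSum_nonneg φ μ x))
    calc (L : ℝ) ^ (d + 1) * UP μ ≤ ∑ x : ↥(R'.image (blk L)), (L : ℝ) * lineSum R' φ μ x := hstep
      _ = (L : ℝ) * ∑ x : ↥(R'.image (blk L)), lineSum R' φ μ x := by rw [Finset.mul_sum]
      _ ≤ (L : ℝ) * ((L : ℝ) * ∑ z : ↥R', bondE R' φ μ z.1) :=
          mul_le_mul_of_nonneg_left (sum_lineSum_le φ μ) (Nat.cast_nonneg L)
      _ = (L : ℝ) ^ 2 * ∑ z : ↥R', bondE R' φ μ z.1 := by ring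
  -- (3) sum over directions
  have h3 : (L : ℝ) ^ (d + 1) * ∑ μ, UP μ ≤ (L : ℝ) ^ 2 * ∑ k : RBond R', (φ (rtgt k) - φ (rsrc k)) ^ 2 := by
    rw [Finset.mul_sum _ _ ((L : ℝ) ^ (d + 1)), ← sum_bondE R' φ, Finset.sum_comm, Finset.mul_sum _ _ ((L : ℝ) ^ 2)]
    exact Finset.sum_le_sum fun μ _ => h2 μ
  have h1' := mul_le_mul_of_nonneg_left h1 hLpow.le
  linarith [h1', h3]

/-! ### §3 The sharp lower comparison: `P_A ⪯ P_B^{Schur}` -/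

/-- **TWO-RUN COMPARISON AT `A = 0`, SHARP LOWER HALF**: `⟨V, P_A V⟩ ≤ ⟨V, P_B^{Schur}V⟩` for every `V` on run A's lattice
(`a > 0`, `n ≥ 1`, `R′` a union of `nL`-blocks) — constant ONE (lens 2's (K2)♯: Löwner `P_A ⪯ P_B^{Schur}`), replacing
`NE7K1LinTwoRunLower.runA_form_le_schurB`'s `c₁ = (3((d+1)L²+1)L^{d−1})⁻¹`.  Route: the Schur form is attained at the optimal
fluctuation (`schur_form_eq_min`); its fine field has block sums `L^{d+1}V` (`blockSum_coordT`); averaging parts EQUAL (`avgPart_eq`);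
Dirichlet parts by `coarseDirichlet_le_sharp` and `bondEnergy_le_dirichletPart`. [folklore] -/
theorem runA_form_le_schurB_sharp {n : ℕ} (hn : 1 ≤ n) (hR' : IsBlockUnion (n * L) R') {a : ℝ} (ha : 0 < a)
    (V : ↥(R'.image (blk L)) → ℝ) :
    V ⬝ᵥ (runA n L a R').mulVec V ≤ V ⬝ᵥ (twoCutoffLine (isBlockUnion_fine hR') n a 1).mulVec V := by
  classical
  have hL : 1 ≤ L := NeZero.one_le
  have hR'L : IsBlockUnion L R' := isBlockUnion_fine hR'
  have hRc : IsBlockUnion n (R'.image (blk L)) := isBlockUnion_coarse hL hR'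
  have hnL : 1 ≤ n * L := Nat.one_le_iff_ne_zero.2 (Nat.mul_ne_zero (Nat.one_le_iff_ne_zero.1 hn) (NeZero.ne L))
  have hL0 : (L : ℝ) ≠ 0 := by exact_mod_cast (NeZero.ne L)
  have hLpos : (0 : ℝ) < L := by exact_mod_cast hL
  have hLpow : (0 : ℝ) < (L : ℝ) ^ (d + 1) := pow_pos hLpos _
  have hmin : 0 < min 2 a := lt_min (by norm_num) ha
  -- the Schur form is attained at the optimal fluctuation
  set H := runB hR'L n a with hH
  have hsymm : H.IsSymm := runB_isSymm hR'L n a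
  have hblocks := (Matrix.isSymm_fromBlocks_iff.1 (by rw [fromBlocks_toBlocks H]; exact hsymm))
  have hH₁' : ∀ u, min 2 a / (L : ℝ) ^ (d + 1) * (u ⬝ᵥ u) ≤
      u ⬝ᵥ (fromBlocks H.toBlocks₁₁ H.toBlocks₁₂ H.toBlocks₂₁ H.toBlocks₂₂).mulVec u := by
    intro u
    rw [fromBlocks_toBlocks]
    have h := coercive_congr (coordT hR'L) (fineOpR (n * L) a 0 R') (c := ((L : ℝ) ^ (d + 1))⁻¹) (σM := min 2 a)
      (cT := 1) (by positivity) hmin.le (fun φ => lower18_zero hnL ha.le hR' φ) (dot_le_coordT hR'L) u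
    have hσ' : ((L : ℝ) ^ (d + 1))⁻¹ * min 2 a * 1 = min 2 a / (L : ℝ) ^ (d + 1) := by field_simp
    rw [hσ'] at h
    exact h
  have hDu : IsUnit (H.toBlocks₂₂).det := isUnit_det_fineR _ _ _ _ (div_pos hmin hLpow) hH₁'
  set ψ : ↥(R'.image (blk L)) × NZ d L → ℝ := -((H.toBlocks₂₂)⁻¹.mulVec ((H.toBlocks₂₁).mulVec V)) with hψ
  have hmin_eq : V ⬝ᵥ (twoCutoffLine hR'L n a 1).mulVec V = Sum.elim V ψ ⬝ᵥ H.mulVec (Sum.elim V ψ) := by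
    have h := schur_form_eq_min H.toBlocks₁₁ H.toBlocks₁₂ H.toBlocks₂₁ H.toBlocks₂₂ hblocks.2.1 hblocks.2.2.2 hDu V
    rw [fromBlocks_toBlocks] at h
    rw [twoCutoffLine_one, h]
  -- the optimal fine field and its block sums
  set φ : ↥R' → ℝ := (coordT hR'L).mulVec (Sum.elim V ψ) with hφdef
  have hφ : ∀ b, ∑ x' ∈ Finset.univ.filter (fun x' => rblk L R' x' = b), φ x' = (L : ℝ) ^ (d + 1) * V b :=
    fun b => blockSum_coordT hR'L (Sum.elim V ψ) b
  have hform : Sum.elim V ψ ⬝ᵥ H.mulVec (Sum.elim V ψ) = ((L : ℝ) ^ (d + 1))⁻¹ * (φ ⬝ᵥ (fineOpR (n * L) a 0 R').mulVec φ) := by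
    rw [hH, runB, dot_congr_mulVec]
  -- run A's form and run B's form in Dirichlet + averaging parts
  rw [show twoCutoffLine (isBlockUnion_fine hR') n a 1 = twoCutoffLine hR'L n a 1 from rfl, hmin_eq, hform,
    fineOpR_form hnL hR' a 0 φ, runA, fineOpR_form hn hRc a 0 V, zero_mul, add_zero, zero_mul, add_zero]
  have havg_eq := avgPart_eq hn a φ V hφ
  -- abbreviations
  set Etot := ∑ k : RBond R', (φ (rtgt k) - φ (rsrc k)) ^ 2 with hEtot
  set COARSE := ∑ x : ↥(R'.image (blk L)), ∑ y : ↥(R'.image (blk L)),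
    (if y.1 ∈ nbrs x.1 then (V x - V y) ^ 2 else 0) with hCOARSE
  set FINE := ∑ x : ↥R', ∑ y : ↥R', (if y.1 ∈ nbrs x.1 then (φ x - φ y) ^ 2 else 0) with hFINE
  -- (i) sharp coarse Dirichlet bound, (ii) `(nL)²·Etot ≤` fine Dirichlet part
  have hcoarse : (L : ℝ) ^ (d + 1) * COARSE ≤ 2 * (L : ℝ) ^ 2 * Etot := coarseDirichlet_le_sharp hR'L φ V hφ
  have hfine : (((n * L : ℕ) : ℝ)) ^ 2 * Etot ≤ ((n * L : ℕ) : ℝ) ^ 2 / 2 * FINE := bondEnergy_le_dirichletPart (n * L) R' φ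
  -- Dirichlet comparison: `(n²/2)·COARSE ≤ L^{−(d+1)}·((nL)²/2)·FINE`
  have hdir : (n : ℝ) ^ 2 / 2 * COARSE ≤ ((L : ℝ) ^ (d + 1))⁻¹ * (((n * L : ℕ) : ℝ) ^ 2 / 2 * FINE) := by
    refine le_of_mul_le_mul_left ?_ hLpow
    rw [← mul_assoc ((L : ℝ) ^ (d + 1)) (((L : ℝ) ^ (d + 1))⁻¹), mul_inv_cancel₀ hLpow.ne', one_mul]
    have h1 : (n : ℝ) ^ 2 / 2 * ((L : ℝ) ^ (d + 1) * COARSE) ≤ (n : ℝ) ^ 2 / 2 * (2 * (L : ℝ) ^ 2 * Etot) :=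
      mul_le_mul_of_nonneg_left hcoarse (by positivity)
    have e2 : (n : ℝ) ^ 2 / 2 * (2 * (L : ℝ) ^ 2 * Etot) = ((n * L : ℕ) : ℝ) ^ 2 * Etot := by
      push_cast
      ring
    have e1 : (L : ℝ) ^ (d + 1) * ((n : ℝ) ^ 2 / 2 * COARSE) = (n : ℝ) ^ 2 / 2 * ((L : ℝ) ^ (d + 1) * COARSE) := by ring
    rw [e1]
    linarith [h1, hfine, e2.le, e2.ge]
  linarith [hdir, havg_eq]

end Pair

end Summit.QuantumFields.BalabanUV.T4Continuum.NE7K1LinTwoRunJensen
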